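import Literature.Probability.Percolation.PercolationProofs
import Literature.Probability.LatticeModels.SahiThirdOrderCorrelation
import Summits.CriticalPhenomena.PercolationContinuityZ3.Theorems.AdditiveGluing.Negative.CertWeighted

/-!
# The independent-copy comparison `(P_k)` and W-domination (WDOM) are FALSE:
# a certified 6-vertex weighted counterexample (Sahi programme, prover prim-sahi-p2 gen 38)

Support file of the cell `prim-sahi` (`--supports stmt-CriticalPhenomena-4575`).  No definitions, no
named facts, no sorries; three `native_decide` evaluations (declared below).  Notation as in
`…IncStarPkCriterion` (p2 gen 34): root `s`, targets `b, c`, third vertex `y`, `B_v = {s ↔ v}`,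
`q_S = P(S ⊆ C_s)`, and

  `G_y := 2 q_{bcy} + 2 q_b q_c q_y − q_b q_{cy} − q_c q_{by} − 2 q_y q_{bc} = Cov(1_{B_y}, W_{bc})`,
  `W_{bc} = 2·1_{B_b ∩ B_c} − q_b 1_{B_c} − q_c 1_{B_b}`.

`(P_y)`: `G_y ≥ 0` for every finite weighted graph (census W137 of prim-sahi-census "S(A) ≥ 0", p2 gen 4
(15c), gen 33 §9, gen 34 memo §1; the hypothesis of `IncStar.incStar_nonneg_of_pk`); WDOM (p2 gens 34–37):
`Cov(f(C_s), W_{bc}) ≥ 0` for every increasing function `f` of the cluster SET `C_s` — WDOM at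
`f = 1{y ∈ C_s}` is `(P_y)`.  Both were clean in every census of the cell (≈ 10⁹ exact instances,
exhaustive on ≤ 6 vertices over the alphabet `{0, ½, 1}`, adversarial climbs to 12 vertices).
**Both are false.**

THE WITNESS (found by a first-order analysis at the degenerate face "near-sure root–target pair",
memo `run/shared/lean/prim/prim-sahi/FROM-prim-sahi-p2-gen38-PK-WDOM-REFUTED.md`):
vertices `s = 0`, `c = 1`, `b = 2`, `u = 3`, `y = 4`, `v = 5`; weights
`b–u 1/10, u–c 9/10, u–s 1/10, b–c 9/10` (target `b` hangs off the target `c`, weak link `u–s`),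
`y–v 1/10, v–s 9/10, v–c 1/10, y–s 9/10` (`y` hangs off the root, weak link `v–c`), and the root–target
pair `s–c` of weight `1 − 10⁻⁷`.  Then, EXACTLY (2⁹ sub-configurations, rational arithmetic),

  `G_y = −4755091594663627319493999891 / (2.5 · 10⁴⁴) ≈ −1.902 · 10⁻¹⁷ < 0`

(`pk_cex`), while Sahi's functional is positive there, `E₃(B_b, B_c, B_y) ≈ +6.83 · 10⁻⁸`
(`istar_pos_at_pkCex`): the increasing-star inequality ISTAR survives; only its sufficient condition
`(P_y)` and the W-domination conjecture die.  Mechanism (memo §1): on the face `w(s,c) = 1 − ε`,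
`G_y = ε·g₁ + O(ε²)` with the closed form `g₁ = L_{j2}² (1 + ρ − ρ²)` for one block law `L` used on both
sides, `ρ = (Harris slack of the block) / L_{j2}`; `g₁ < 0` iff `ρ` exceeds the golden ratio, and the
triangle-with-pendant block reaches `ρ → 2`.  The window is `ε ≲ 10⁻⁶`, below every census alphabet.

Method = the exact-rational weighted machinery of `AdditiveGluing/Negative/CertWeighted.lean`
(`prodBernoulli_real_eq_wsum`: under `prodBernoulli (wOfList l)` every probability is a weighted count over
the sub-configurations; reach tables `testBit_reachTable_iff_mem_openConn`); here the two- and three-fold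
connection probabilities are read off the same tables (`real_inter_openConn_eq_wcount`,
`real_inter3_openConn_eq_wcount`), `pk_neg_of_wcheck` / `sahiE3_pos_of_wcheck` turn a rational check into
the real inequality, and the checks are evaluated by `native_decide` (DECLARED: `pk_cex`,
`istar_pos_at_pkCex` and the weight check inside them depend on `Lean.ofReduceBool`).

Corollaries: `not_pk_forall` (the universally quantified `(P_y)` is false) and `not_wdom_forall` (the
W-domination inequality of `IncStar.wdom_twoPronged` / `wdom_targetCut`, asserted for ALL roots, is false:
take `𝒜 = {S | y ∈ S}`).  Nothing here touches the crux `NoHeavyLowerTail`, Sahi's `C₃`, or the proved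
WDOM theorems for two-pronged roots / pendant targets / target cuts.
-/

namespace Summit.CriticalPhenomena.PercolationContinuityZ3.Theorems

namespace IncStar

open MeasureTheory
open Literature.Probability.LatticeModels Literature.Probability.Percolation
open Summit.CriticalPhenomena.PercolationContinuityZ3.Theorems.AdditiveGluing.Negative.Cert

/-! ### Two- and three-fold connection probabilities as weighted counts -/

/-- `P(o ↔ a ∧ o ↔ b)` is the weighted count of the reach-table test "bits `a` and `b` of row `o`".
[this work] -/
theorem real_inter_openConn_eq_wcount {n : ℕ} {l : List (Fin n × Fin n × ℚ)} (hnd : (wPairs l).Nodup)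
    (hq : ∀ e ∈ l, 0 ≤ e.2.2 ∧ e.2.2 ≤ 1) (o a b : Fin n) :
    (prodBernoulli (wOfList l)).real (openConn o a ∩ openConn o b) =
      ((((wtabs n l).map fun t =>
        if (t.1.getD o 0).testBit a && (t.1.getD o 0).testBit b then t.2 else 0).sum : ℚ) : ℝ) := by
  classical
  rw [prodBernoulli_real_eq_wsum hnd hq]
  exact (cast_sum_wtabs_pos l (fun tb => (tb.getD o 0).testBit a && (tb.getD o 0).testBit b)
    (fun S => (↑S : Set (Sym2 (Fin n))) ∈ openConn o a ∩ openConn o b)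
    (fun ω => by
      rw [Bool.and_eq_true, testBit_reachTable_iff_mem_openConn, testBit_reachTable_iff_mem_openConn]
      rfl)).symm

/-- `P(o ↔ a ∧ o ↔ b ∧ o ↔ c)` is the weighted count of the reach-table test "bits `a`, `b`, `c` of row `o`".
[this work] -/
theorem real_inter3_openConn_eq_wcount {n : ℕ} {l : List (Fin n × Fin n × ℚ)} (hnd : (wPairs l).Nodup)
    (hq : ∀ e ∈ l, 0 ≤ e.2.2 ∧ e.2.2 ≤ 1) (o a b c : Fin n) :
    (prodBernoulli (wOfList l)).real (openConn o a ∩ openConn o b ∩ openConn o c) =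
      ((((wtabs n l).map fun t =>
        if (t.1.getD o 0).testBit a && (t.1.getD o 0).testBit b && (t.1.getD o 0).testBit c
          then t.2 else 0).sum : ℚ) : ℝ) := by
  classical
  rw [prodBernoulli_real_eq_wsum hnd hq]
  exact (cast_sum_wtabs_pos l
    (fun tb => (tb.getD o 0).testBit a && (tb.getD o 0).testBit b && (tb.getD o 0).testBit c)
    (fun S => (↑S : Set (Sym2 (Fin n))) ∈ openConn o a ∩ openConn o b ∩ openConn o c)
    (fun ω => by
      rw [Bool.and_eq_true, Bool.and_eq_true, testBit_reachTable_iff_mem_openConn,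
        testBit_reachTable_iff_mem_openConn, testBit_reachTable_iff_mem_openConn]
      simp only [Set.mem_inter_iff, and_assoc])).symm

/-- **From a rational check to `G_y < 0`.**  For a weighted edge list `l` (distinct pairs, weights in
`[0,1]`), root `s` and vertices `b, c, y`: if the exact rational
`2·#(bcy) + 2·#(b)#(c)#(y) − #(b)·#(cy) − #(c)·#(by) − 2·#(y)·#(bc)` (weighted reach-table counts) is
negative, then `G_y < 0` under `prodBernoulli (wOfList l)`. [this work] -/
theorem pk_neg_of_wcheck {n : ℕ} (l : List (Fin n × Fin n × ℚ)) (hnd : (wPairs l).Nodup)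
    (hq : ∀ e ∈ l, 0 ≤ e.2.2 ∧ e.2.2 ≤ 1) (s b c y : Fin n)
    (h : 2 * ((wtabs n l).map fun t =>
          if (t.1.getD s 0).testBit b && (t.1.getD s 0).testBit c && (t.1.getD s 0).testBit y
            then t.2 else 0).sum
        + 2 * (wConn (wtabs n l) s b * wConn (wtabs n l) s c * wConn (wtabs n l) s y)
        - wConn (wtabs n l) s b * ((wtabs n l).map fun t =>
            if (t.1.getD s 0).testBit c && (t.1.getD s 0).testBit y then t.2 else 0).sum
        - wConn (wtabs n l) s c * ((wtabs n l).map fun t =>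
            if (t.1.getD s 0).testBit b && (t.1.getD s 0).testBit y then t.2 else 0).sum
        - 2 * (wConn (wtabs n l) s y * ((wtabs n l).map fun t =>
            if (t.1.getD s 0).testBit b && (t.1.getD s 0).testBit c then t.2 else 0).sum) < 0) :
    2 * (prodBernoulli (wOfList l)).real (openConn s b ∩ openConn s c ∩ openConn s y)
      + 2 * ((prodBernoulli (wOfList l)).real (openConn s b) * (prodBernoulli (wOfList l)).real (openConn s c)
          * (prodBernoulli (wOfList l)).real (openConn s y))
      - (prodBernoulli (wOfList l)).real (openConn s b) * (prodBernoulli (wOfList l)).real (openConn s c ∩ openConn s y)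
      - (prodBernoulli (wOfList l)).real (openConn s c) * (prodBernoulli (wOfList l)).real (openConn s b ∩ openConn s y)
      - 2 * ((prodBernoulli (wOfList l)).real (openConn s y)
          * (prodBernoulli (wOfList l)).real (openConn s b ∩ openConn s c)) < 0 := by
  rw [real_inter3_openConn_eq_wcount hnd hq, real_inter_openConn_eq_wcount hnd hq,
    real_inter_openConn_eq_wcount hnd hq, real_inter_openConn_eq_wcount hnd hq,
    real_openConn_eq_wConn hnd hq, real_openConn_eq_wConn hnd hq, real_openConn_eq_wConn hnd hq]
  exact_mod_cast h

/-- **From a rational check to `0 < E₃`.**  Same dictionary for Sahi's third-order functional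
`sahiE3 P B C Y = 2P(BCY) + P(B)P(C)P(Y) − (P(B)P(CY) + P(C)P(BY) + P(Y)P(BC))` of the three connection
events. [this work] -/
theorem sahiE3_pos_of_wcheck {n : ℕ} (l : List (Fin n × Fin n × ℚ)) (hnd : (wPairs l).Nodup)
    (hq : ∀ e ∈ l, 0 ≤ e.2.2 ∧ e.2.2 ≤ 1) (s b c y : Fin n)
    (h : 0 < 2 * ((wtabs n l).map fun t =>
          if (t.1.getD s 0).testBit b && (t.1.getD s 0).testBit c && (t.1.getD s 0).testBit y
            then t.2 else 0).sum
        + wConn (wtabs n l) s b * wConn (wtabs n l) s c * wConn (wtabs n l) s y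
        - (wConn (wtabs n l) s b * ((wtabs n l).map fun t =>
              if (t.1.getD s 0).testBit c && (t.1.getD s 0).testBit y then t.2 else 0).sum
            + wConn (wtabs n l) s c * ((wtabs n l).map fun t =>
              if (t.1.getD s 0).testBit b && (t.1.getD s 0).testBit y then t.2 else 0).sum
            + wConn (wtabs n l) s y * ((wtabs n l).map fun t =>
              if (t.1.getD s 0).testBit b && (t.1.getD s 0).testBit c then t.2 else 0).sum)) :
    0 < sahiE3 (prodBernoulli (wOfList l)) (openConn s b) (openConn s c) (openConn s y) := by
  rw [sahiE3_def, real_inter3_openConn_eq_wcount hnd hq, real_inter_openConn_eq_wcount hnd hq,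
    real_inter_openConn_eq_wcount hnd hq, real_inter_openConn_eq_wcount hnd hq,
    real_openConn_eq_wConn hnd hq, real_openConn_eq_wConn hnd hq, real_openConn_eq_wConn hnd hq]
  exact_mod_cast h

/-! ### The witness -/

/-- **`(P_y)` fails on six vertices.**  For the weighted edge list
`[(2,3,1/10), (3,1,9/10), (3,0,1/10), (2,1,9/10), (4,5,1/10), (5,0,9/10), (5,1,1/10), (4,0,9/10), (0,1,1−10⁻⁷)]`
on `Fin 6`, root `s = 0`, targets `b = 2`, `c = 1` and `y = 4`:
`2P(B∩C∩Y) + 2P(B)P(C)P(Y) − P(B)P(C∩Y) − P(C)P(B∩Y) − 2P(Y)P(B∩C) < 0` (exactly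
`−4755091594663627319493999891 / (2.5·10⁴⁴)`), i.e. `G_y = Cov(1_Y, W_{BC}) < 0` in the notation of
`IncStar.pk_eq_two_cov_sub`.  DECLARED `native_decide` (weight check and the rational check). [this work] -/
theorem pk_cex :
    2 * (prodBernoulli (wOfList ([(2, 3, 1/10), (3, 1, 9/10), (3, 0, 1/10), (2, 1, 9/10), (4, 5, 1/10),
            (5, 0, 9/10), (5, 1, 1/10), (4, 0, 9/10), (0, 1, 1 - 1/10^7)] : List (Fin 6 × Fin 6 × ℚ)))).real
          (openConn (0 : Fin 6) 2 ∩ openConn (0 : Fin 6) 1 ∩ openConn (0 : Fin 6) 4)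
      + 2 * ((prodBernoulli (wOfList ([(2, 3, 1/10), (3, 1, 9/10), (3, 0, 1/10), (2, 1, 9/10), (4, 5, 1/10),
            (5, 0, 9/10), (5, 1, 1/10), (4, 0, 9/10), (0, 1, 1 - 1/10^7)] : List (Fin 6 × Fin 6 × ℚ)))).real
              (openConn (0 : Fin 6) 2)
          * (prodBernoulli (wOfList ([(2, 3, 1/10), (3, 1, 9/10), (3, 0, 1/10), (2, 1, 9/10), (4, 5, 1/10),
            (5, 0, 9/10), (5, 1, 1/10), (4, 0, 9/10), (0, 1, 1 - 1/10^7)] : List (Fin 6 × Fin 6 × ℚ)))).real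
              (openConn (0 : Fin 6) 1)
          * (prodBernoulli (wOfList ([(2, 3, 1/10), (3, 1, 9/10), (3, 0, 1/10), (2, 1, 9/10), (4, 5, 1/10),
            (5, 0, 9/10), (5, 1, 1/10), (4, 0, 9/10), (0, 1, 1 - 1/10^7)] : List (Fin 6 × Fin 6 × ℚ)))).real
              (openConn (0 : Fin 6) 4))
      - (prodBernoulli (wOfList ([(2, 3, 1/10), (3, 1, 9/10), (3, 0, 1/10), (2, 1, 9/10), (4, 5, 1/10),
            (5, 0, 9/10), (5, 1, 1/10), (4, 0, 9/10), (0, 1, 1 - 1/10^7)] : List (Fin 6 × Fin 6 × ℚ)))).real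
              (openConn (0 : Fin 6) 2)
          * (prodBernoulli (wOfList ([(2, 3, 1/10), (3, 1, 9/10), (3, 0, 1/10), (2, 1, 9/10), (4, 5, 1/10),
            (5, 0, 9/10), (5, 1, 1/10), (4, 0, 9/10), (0, 1, 1 - 1/10^7)] : List (Fin 6 × Fin 6 × ℚ)))).real
              (openConn (0 : Fin 6) 1 ∩ openConn (0 : Fin 6) 4)
      - (prodBernoulli (wOfList ([(2, 3, 1/10), (3, 1, 9/10), (3, 0, 1/10), (2, 1, 9/10), (4, 5, 1/10),
            (5, 0, 9/10), (5, 1, 1/10), (4, 0, 9/10), (0, 1, 1 - 1/10^7)] : List (Fin 6 × Fin 6 × ℚ)))).real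
              (openConn (0 : Fin 6) 1)
          * (prodBernoulli (wOfList ([(2, 3, 1/10), (3, 1, 9/10), (3, 0, 1/10), (2, 1, 9/10), (4, 5, 1/10),
            (5, 0, 9/10), (5, 1, 1/10), (4, 0, 9/10), (0, 1, 1 - 1/10^7)] : List (Fin 6 × Fin 6 × ℚ)))).real
              (openConn (0 : Fin 6) 2 ∩ openConn (0 : Fin 6) 4)
      - 2 * ((prodBernoulli (wOfList ([(2, 3, 1/10), (3, 1, 9/10), (3, 0, 1/10), (2, 1, 9/10), (4, 5, 1/10),
            (5, 0, 9/10), (5, 1, 1/10), (4, 0, 9/10), (0, 1, 1 - 1/10^7)] : List (Fin 6 × Fin 6 × ℚ)))).real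
              (openConn (0 : Fin 6) 4)
          * (prodBernoulli (wOfList ([(2, 3, 1/10), (3, 1, 9/10), (3, 0, 1/10), (2, 1, 9/10), (4, 5, 1/10),
            (5, 0, 9/10), (5, 1, 1/10), (4, 0, 9/10), (0, 1, 1 - 1/10^7)] : List (Fin 6 × Fin 6 × ℚ)))).real
              (openConn (0 : Fin 6) 2 ∩ openConn (0 : Fin 6) 1)) < 0 :=
  pk_neg_of_wcheck _ (by decide) (by native_decide) 0 2 1 4 (by native_decide)

/-- **Sahi's increasing star holds at the same witness**: `0 < sahiE3 P {0↔2} {0↔1} {0↔4}`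
(≈ `+6.83·10⁻⁸`) — the witness kills `(P_y)` / WDOM but not ISTAR.  DECLARED `native_decide`. [this work] -/
theorem istar_pos_at_pkCex :
    0 < sahiE3 (prodBernoulli (wOfList ([(2, 3, 1/10), (3, 1, 9/10), (3, 0, 1/10), (2, 1, 9/10), (4, 5, 1/10),
            (5, 0, 9/10), (5, 1, 1/10), (4, 0, 9/10), (0, 1, 1 - 1/10^7)] : List (Fin 6 × Fin 6 × ℚ))))
      (openConn (0 : Fin 6) 2) (openConn (0 : Fin 6) 1) (openConn (0 : Fin 6) 4) :=
  sahiE3_pos_of_wcheck _ (by decide) (by native_decide) 0 2 1 4 (by native_decide)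

/-! ### The universally quantified conjectures are false -/

/-- **`(P_y)` is false in general.**  It is NOT true that for every finite weighted graph, root `s` and
vertices `b, c, y`: `0 ≤ 2 q_{bcy} + 2 q_b q_c q_y − q_b q_{cy} − q_c q_{by} − 2 q_y q_{bc}`
(the hypothesis `hP` of `IncStar.incStar_nonneg_of_pk`; census W137 "S(A) ≥ 0"). [this work] -/
theorem not_pk_forall :
    ¬ ∀ (n : ℕ) (w : Sym2 (Fin n) → unitInterval) (s b c y : Fin n),
      0 ≤ 2 * (prodBernoulli w).real (openConn s b ∩ openConn s c ∩ openConn s y)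
        + 2 * ((prodBernoulli w).real (openConn s b) * (prodBernoulli w).real (openConn s c)
            * (prodBernoulli w).real (openConn s y))
        - (prodBernoulli w).real (openConn s b) * (prodBernoulli w).real (openConn s c ∩ openConn s y)
        - (prodBernoulli w).real (openConn s c) * (prodBernoulli w).real (openConn s b ∩ openConn s y)
        - 2 * ((prodBernoulli w).real (openConn s y) * (prodBernoulli w).real (openConn s b ∩ openConn s c)) := by
  intro h
  have h0 := h 6 (wOfList ([(2, 3, 1/10), (3, 1, 9/10), (3, 0, 1/10), (2, 1, 9/10), (4, 5, 1/10),
            (5, 0, 9/10), (5, 1, 1/10), (4, 0, 9/10), (0, 1, 1 - 1/10^7)] : List (Fin 6 × Fin 6 × ℚ))) 0 2 1 4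
  have h1 := pk_cex
  linarith

/-- **W-domination is false in general.**  It is NOT true that for every finite weighted graph, root `s`,
targets `i, j` and every up-closed family `𝒜` of vertex sets,
`0 ≤ 2P({C_s ∈ 𝒜} ∩ B_i ∩ B_j) − q_j P({C_s ∈ 𝒜} ∩ B_i) − q_i P({C_s ∈ 𝒜} ∩ B_j) − (2q_{ij} − 2q_iq_j) P(C_s ∈ 𝒜)`
(the conclusion of `IncStar.wdom_twoPronged` / `wdom_pendant` / `wdom_targetCut`, which remain theorems for
their classes of roots): the family `𝒜 = {S | y ∈ S}` at the witness has this quantity `= G_y < 0`.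
[this work] -/
theorem not_wdom_forall :
    ¬ ∀ (n : ℕ) (w : Sym2 (Fin n) → unitInterval) (s i j : Fin n) (𝒜 : Set (Set (Fin n))),
      (∀ S T : Set (Fin n), S ∈ 𝒜 → S ⊆ T → T ∈ 𝒜) →
      0 ≤ 2 * (prodBernoulli w).real ({ω | openCluster ω s ∈ 𝒜} ∩ openConn s i ∩ openConn s j)
        - (prodBernoulli w).real (openConn s j) * (prodBernoulli w).real ({ω | openCluster ω s ∈ 𝒜} ∩ openConn s i)
        - (prodBernoulli w).real (openConn s i) * (prodBernoulli w).real ({ω | openCluster ω s ∈ 𝒜} ∩ openConn s j)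
        - (2 * (prodBernoulli w).real (openConn s i ∩ openConn s j)
            - 2 * ((prodBernoulli w).real (openConn s i) * (prodBernoulli w).real (openConn s j)))
          * (prodBernoulli w).real {ω | openCluster ω s ∈ 𝒜} := by
  intro h
  have hup : ∀ S T : Set (Fin 6), S ∈ {S : Set (Fin 6) | (4 : Fin 6) ∈ S} → S ⊆ T →
      T ∈ {S : Set (Fin 6) | (4 : Fin 6) ∈ S} := fun S T hS hST => hST hS
  have h0 := h 6 (wOfList ([(2, 3, 1/10), (3, 1, 9/10), (3, 0, 1/10), (2, 1, 9/10), (4, 5, 1/10),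
            (5, 0, 9/10), (5, 1, 1/10), (4, 0, 9/10), (0, 1, 1 - 1/10^7)] : List (Fin 6 × Fin 6 × ℚ)))
    0 2 1 {S | (4 : Fin 6) ∈ S} hup
  have hA : {ω : BondConfig (Fin 6) | openCluster ω 0 ∈ {S : Set (Fin 6) | (4 : Fin 6) ∈ S}} =
      openConn (0 : Fin 6) 4 := by
    ext ω; simp [openCluster, openConn]
  rw [hA] at h0
  have h1 := pk_cex
  have e1 : openConn (0 : Fin 6) 4 ∩ openConn (0 : Fin 6) 2 ∩ openConn (0 : Fin 6) 1 =
      openConn (0 : Fin 6) 2 ∩ openConn (0 : Fin 6) 1 ∩ openConn (0 : Fin 6) 4 := by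
    ext ω; simp only [Set.mem_inter_iff]; tauto
  have e2 : openConn (0 : Fin 6) 4 ∩ openConn (0 : Fin 6) 2 = openConn (0 : Fin 6) 2 ∩ openConn (0 : Fin 6) 4 :=
    Set.inter_comm _ _
  have e3 : openConn (0 : Fin 6) 4 ∩ openConn (0 : Fin 6) 1 = openConn (0 : Fin 6) 1 ∩ openConn (0 : Fin 6) 4 :=
    Set.inter_comm _ _
  rw [e1, e2, e3] at h0
  linarith

end IncStar

end Summit.CriticalPhenomena.PercolationContinuityZ3.Theorems
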